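import Summits.ResolutionOfSingularities.ResolutionOfSingularities.Theses.UniformComplexity
import HarnessLib

/-!
# Route `UniformComplexity` — assembly (stmt-ResolutionOfSingularities-14699)

Route `ResolutionOfSingularities/UniformComplexity`. The assembly item is the TYPE of the route's
deciding theorem `Theses.UniformComplexity.closes`:
`PrimeClosureThesis → PrimeModelTransfer → DescentAlgclosedToPerfect → DescentPerfectToAll →
ResolutionOfSingularities`; it is closed by `closes` itself (pure logic; the proved supports
`DescentReducedToIntegral`, `EmbeddedToNonembedded` and — as of p165315 — `FiniteToClosure` are used
inside `closes` or are side rungs). No mathematics is added here.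
-/

set_option linter.dupNamespace false -- mandated namespace of this single-conjunct summit

namespace Summit.ResolutionOfSingularities.ResolutionOfSingularities.Theorems.UniformComplexity

/-- **Assembly of route `UniformComplexity` (stmt-ResolutionOfSingularities-14699)**: the target
over `𝔽̄_p` and the three transfer/descent cruxes imply the summit statement — by the route's
deciding theorem `closes`. [folklore] -/
theorem assembly_proof :
    Summit.ResolutionOfSingularities.ResolutionOfSingularities.Theses.UniformComplexity.Assembly :=
  fun hRB hPM hAP hPA =>
    Summit.ResolutionOfSingularities.ResolutionOfSingularities.Theses.UniformComplexity.closes hRB hPM hAP hPA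

end Summit.ResolutionOfSingularities.ResolutionOfSingularities.Theorems.UniformComplexity
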